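import Literature.NumberTheory.Weil1964.ArchWeilDatum
import Literature.Analysis.SegalBargmann.SchwartzCompactWeilDatum
import HarnessLib

/-!
# Change of polarisation for an archimedean Weil datum

Source of the notion: the tree's hypothesis structure `IsArchWeilDatum ι𝕎 ω` (file `ArchWeilDatum`; G. B. Folland,
*Harmonic Analysis in Phase Space* (1989), Ch. 4 §2 (4.23), Prop. (4.27); MVW 1987 Chap. 2 II.1 (A)–(B)) and the
tree's compact Weil operators `unitaryOpPi` (file `SchwartzUnitaryIdentification`, Folland Prop. (4.39)).

Everything here is PROVED; no statement of print is asserted or used as a hypothesis.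

## Main results

* `conjRep S ω` : the conjugate `g ↦ S ∘ ω g ∘ S⁻¹` of a representation by a linear automorphism of the carrier.
* **`IsArchWeilDatum.conj`**: if `(s, S) ∈ MpPsi ρ_∞` with `S` a homeomorphism of `𝓢(ℝ^σ)` having a unitary lift,
  then conjugating a datum `(ι𝕎, ω)` gives a datum `(s ι𝕎 s⁻¹, S ω S⁻¹)` — the abstract form of a change of
  Lagrangian / polarisation.
* `unitaryEquivPi u` : `unitaryOpPi u` as a `≃L`, and **`IsArchWeilDatum.conj_unitary`**: the special case
  `s = realifySp u`, `S = unitaryOpPi u` (`u ∈ U(σ)`), which FIXES the Gaussian `hermitePi 0`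
  (`unitaryOpPi_hermitePi_zero`); hence vacuum eigen-scalars are unchanged (`conjRep_apply_eq_smul`).

These are the tools by which an instance moves a unipotent one-parameter subgroup of `G_∞` into the Siegel
parabolic of the standard frame before applying the zero-point pin `IsArchWeilDatum.apply_eq_chirpS`.

## References

* [Folland1989] G. B. Folland, *Harmonic Analysis in Phase Space*, Annals of Mathematics Studies 122, Princeton
  UP, 1989, Ch. 4 §2 (4.23), Prop. (4.27), Prop. (4.39) (doi:10.1515/9781400882427).
* [MoeglinVignerasWaldspurger1987] C. Moeglin, M.-F. Vignéras, J.-L. Waldspurger, *Correspondances de Howe sur un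
  corps p-adique*, LNM 1291, Springer, 1987, Chap. 2, II.1–II.2 (doi:10.1007/BFb0082712).
-/

set_option autoImplicit false

noncomputable section

open MeasureTheory Complex SchwartzMap

namespace Literature.NumberTheory.Weil1964

open Literature.Analysis.SegalBargmann Literature.RepresentationTheory.HeisenbergGroup

/-! ## 1. Conjugating a representation by an automorphism of the carrier -/

section ConjRep

variable {G : Type*} [Group G] {V : Type*} [AddCommGroup V] [Module ℂ V]

/-- The conjugate representation `g ↦ S ∘ ω g ∘ S⁻¹`. [folklore] -/
def conjRep (S : V ≃ₗ[ℂ] V) (ω : Representation ℂ G V) : Representation ℂ G V where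
  toFun g := S.conj (ω g)
  map_one' := by
    rw [map_one]
    exact LinearEquiv.conj_id S
  map_mul' g h := by
    rw [map_mul, Module.End.mul_eq_comp, LinearEquiv.conj_comp]
    rfl

/-- Unfolding: `conjRep S ω g f = S (ω g (S.symm f))`. [folklore] -/
@[simp] theorem conjRep_apply (S : V ≃ₗ[ℂ] V) (ω : Representation ℂ G V) (g : G) (f : V) :
    conjRep S ω g f = S (ω g (S.symm f)) := by
  show (S.conj (ω g)) f = _
  rw [LinearEquiv.conj_apply_apply]

/-- A vector fixed by `S` keeps its eigen-scalars under conjugation. [folklore] -/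
theorem conjRep_apply_eq_smul (S : V ≃ₗ[ℂ] V) (ω : Representation ℂ G V) {v : V} (hv : S v = v) {g : G} {c : ℂ}
    (h : ω g v = c • v) : conjRep S ω g v = c • v := by
  have hv' : S.symm v = v := by rw [LinearEquiv.symm_apply_eq, hv]
  rw [conjRep_apply, hv', h, map_smul, hv]

end ConjRep

/-! ## 2. Conjugating a datum by an implementer -/

variable {σ : Type*} [Fintype σ] [DecidableEq σ]
variable {Ginf : Type*} [Group Ginf] [TopologicalSpace Ginf]

local notation "L2R" σ => Lp ℂ 2 (volume : Measure (σ → ℝ))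
local notation "SR" σ => SchwartzMap (σ → ℝ) ℂ
local notation "PV" σ => (σ → ℝ) × (σ → ℝ)
local notation "SpR" σ => symplecticGroup (polar (dotPairing σ))

namespace IsArchWeilDatum

variable {ι𝕎 : Ginf →* SpR σ} {ω : Representation ℂ Ginf (SR σ)}

/-- Products in the automorphism group act by composition. [folklore] -/
theorem _root_.Literature.NumberTheory.Weil1964.linearEquiv_conj_mul_apply {V : Type*} [AddCommGroup V]
    [Module ℂ V] (A B : V ≃ₗ[ℂ] V) (x : V) : (A * B * A⁻¹) x = A (B (A.symm x)) := rfl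

omit [DecidableEq σ] in
/-- **Change of polarisation.**  Let `(s, S) ∈ MpPsi ρ_∞` with `S : 𝓢 ≃L 𝓢` restricting a unitary `U` of `L²`.
Then `(s ι𝕎 s⁻¹, S ω S⁻¹)` is again an archimedean Weil datum.
[cite: MoeglinVignerasWaldspurger1987, Chap. 2 II.1 (A)–(B)] -/
theorem conj (hW : IsArchWeilDatum ι𝕎 ω) {s : SpR σ} {S : (SR σ) ≃L[ℂ] SR σ}
    (hS : (s, S.toLinearEquiv) ∈ MpPsi (schwartzSchrodinger σ))
    {U : (L2R σ) ≃ₗᵢ[ℂ] L2R σ} (hU : ∀ f : SR σ, toL2 (S f) = U (toL2 f)) :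
    IsArchWeilDatum ((MulAut.conj s).toMonoidHom.comp ι𝕎) (conjRep S.toLinearEquiv ω) := by
  -- `toL2 ∘ S⁻¹ = U⁻¹ ∘ toL2`
  have hUsymm : ∀ f : SR σ, toL2 (S.toLinearEquiv.symm f) = U.symm (toL2 f) := by
    intro f
    have h1 : toL2 f = U (toL2 (S.toLinearEquiv.symm f)) := by
      rw [← hU]
      exact congrArg toL2 (S.apply_symm_apply f).symm
    rw [h1, LinearIsometryEquiv.symm_apply_apply]
  have hι : ∀ g, ((MulAut.conj s).toMonoidHom.comp ι𝕎) g = s * ι𝕎 g * s⁻¹ := fun g => rfl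
  -- (w1)
  have h1 : ∀ f : SR σ, Continuous fun g => conjRep S.toLinearEquiv ω g f := by
    intro f
    have h : (fun g => conjRep S.toLinearEquiv ω g f) = fun g => S (ω g (S.toLinearEquiv.symm f)) := by
      funext g
      rw [conjRep_apply]
      rfl
    rw [h]
    exact S.continuous.comp (hW.continuous_apply (S.toLinearEquiv.symm f))
  -- (w2)
  have h2 : IsPhaseCovariantS
      (fun g => ⇑((((MulAut.conj s).toMonoidHom.comp ι𝕎) g).1 : (PV σ) ≃ₗ[ℝ] PV σ))
      (fun g => conjRep S.toLinearEquiv ω g) := by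
    intro g p q f
    have hm : (s, S.toLinearEquiv) * (ι𝕎 g, repGL ω g) * (s, S.toLinearEquiv)⁻¹ ∈
        MpPsi (schwartzSchrodinger σ) :=
      Subgroup.mul_mem _ (Subgroup.mul_mem _ hS (hW.mem_MpPsi g)) (Subgroup.inv_mem _ hS)
    rw [Prod.inv_mk, Prod.mk_mul_mk, Prod.mk_mul_mk] at hm
    have h := (mem_MpPsi_iff σ (s * ι𝕎 g * s⁻¹) (S.toLinearEquiv * repGL ω g * S.toLinearEquiv⁻¹)).1 hm
      p q f
    rw [linearEquiv_conj_mul_apply, linearEquiv_conj_mul_apply, repGL_apply, repGL_apply] at h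
    beta_reduce
    rw [hι g, conjRep_apply, conjRep_apply]
    exact h
  -- (w2′)
  have h3 : ∀ g, ∃ U' : (L2R σ) ≃ₗᵢ[ℂ] L2R σ, LiftsTo (conjRep S.toLinearEquiv ω g)
      ((U'.toContinuousLinearEquiv : (L2R σ) ≃L[ℂ] L2R σ) : (L2R σ) →L[ℂ] L2R σ) := by
    intro g
    obtain ⟨Ug, hUg⟩ := hW.exists_lift g
    refine ⟨(U.symm.trans Ug).trans U, fun f => ?_⟩
    have hUg' := hUg (S.toLinearEquiv.symm f)
    rw [ContinuousLinearEquiv.coe_coe, LinearIsometryEquiv.coe_toContinuousLinearEquiv] at hUg'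
    rw [conjRep_apply, ContinuousLinearEquiv.coe_coe, LinearIsometryEquiv.coe_toContinuousLinearEquiv,
      LinearIsometryEquiv.trans_apply, LinearIsometryEquiv.trans_apply, ← hUsymm, ← hUg']
    exact hU _
  exact ⟨h1, h2, h3⟩

omit [DecidableEq σ] in
/-- The `LiftsTo` hypothesis of `conj` in the tree's form. [folklore] -/
theorem conj' (hW : IsArchWeilDatum ι𝕎 ω) {s : SpR σ} {S : (SR σ) ≃L[ℂ] SR σ}
    (hS : Implements (schwartzSchrodinger σ) (ofSymplectic _ s) S.toLinearEquiv)
    {U : (L2R σ) ≃ₗᵢ[ℂ] L2R σ}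
    (hU : LiftsTo (S.toLinearEquiv : (SR σ) →ₗ[ℂ] SR σ)
      ((U.toContinuousLinearEquiv : (L2R σ) ≃L[ℂ] L2R σ) : (L2R σ) →L[ℂ] L2R σ)) :
    IsArchWeilDatum ((MulAut.conj s).toMonoidHom.comp ι𝕎) (conjRep S.toLinearEquiv ω) :=
  hW.conj ((Literature.RepresentationTheory.HeisenbergGroup.mem_MpPsi _ _).2 hS) fun f => hU f

/-! ## 3. The unitary change of polarisation fixes the Gaussian -/

omit [TopologicalSpace Ginf] in
/-- `unitaryOpPi u` as a continuous linear automorphism of `𝓢(ℝ^σ)` (inverse `unitaryOpPi u⁻¹`).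
[cite: Folland1989, Prop. (4.39)] -/
def _root_.Literature.NumberTheory.Weil1964.unitaryEquivPi (u : Matrix.unitaryGroup σ ℂ) : (SR σ) ≃L[ℂ] SR σ where
  toLinearMap := (unitaryOpPi u : (SR σ) →L[ℂ] SR σ)
  invFun := unitaryOpPi u⁻¹
  left_inv f := by
    show unitaryOpPi u⁻¹ (unitaryOpPi u f) = f
    rw [← ContinuousLinearMap.comp_apply, ← unitaryOpPi_mul, inv_mul_cancel, unitaryOpPi_one,
      ContinuousLinearMap.id_apply]
  right_inv f := by
    show unitaryOpPi u (unitaryOpPi u⁻¹ f) = f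
    rw [← ContinuousLinearMap.comp_apply, ← unitaryOpPi_mul, mul_inv_cancel, unitaryOpPi_one,
      ContinuousLinearMap.id_apply]
  continuous_toFun := (unitaryOpPi u).continuous
  continuous_invFun := (unitaryOpPi u⁻¹).continuous

omit [TopologicalSpace Ginf] in
/-- Unfolding. [folklore] -/
@[simp] theorem _root_.Literature.NumberTheory.Weil1964.unitaryEquivPi_apply (u : Matrix.unitaryGroup σ ℂ)
    (f : SR σ) : unitaryEquivPi u f = unitaryOpPi u f := rfl

omit [TopologicalSpace Ginf] in
/-- `unitaryOpPi u` implements `realifySp u` (Folland (4.23) over `U(σ)`). [cite: Folland1989, Prop. (4.39)] -/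
theorem _root_.Literature.NumberTheory.Weil1964.implements_unitaryEquivPi (u : Matrix.unitaryGroup σ ℂ) :
    Implements (schwartzSchrodinger σ) (ofSymplectic _ (realifySp σ u))
      (unitaryEquivPi u).toLinearEquiv := by
  have hD := isArchWeilDatum_compactWeilRep (H := Matrix.unitaryGroup σ ℂ) (MonoidHom.id _) (1 : _ →* Circle)
    continuous_id continuous_const
  have h := (implements_ofSymplectic_iff σ _ _).1 (hD.implements u)
  rw [implements_ofSymplectic_iff]
  intro p q f
  have h1 := h p q f
  simp only [repGL_apply, compactWeilRep_apply, MonoidHom.one_apply, Circle.coe_one, one_smul,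
    MonoidHom.coe_comp, Function.comp_apply, MonoidHom.id_apply] at h1
  exact h1

omit [TopologicalSpace Ginf] in
/-- `unitaryOpPi u` restricts the unitary `schrodingerU u`. [cite: Folland1989, Prop. (4.39)] -/
theorem _root_.Literature.NumberTheory.Weil1964.liftsTo_unitaryEquivPi (u : Matrix.unitaryGroup σ ℂ) :
    LiftsTo ((unitaryEquivPi u).toLinearEquiv : (SR σ) →ₗ[ℂ] SR σ)
      (((schrodingerU u).toContinuousLinearEquiv : (L2R σ) ≃L[ℂ] L2R σ) : (L2R σ) →L[ℂ] L2R σ) :=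
  fun f => toL2_unitaryOpPi u f

/-- **Unitary change of polarisation**: for `u ∈ U(σ)` the conjugate
`(realifySp u · ι𝕎 · realifySp u⁻¹, μ₀(u) ω μ₀(u)⁻¹)` is an archimedean Weil datum.
[cite: Folland1989, Prop. (4.39); MoeglinVignerasWaldspurger1987, Chap. 2 II.1 (A)–(B)] -/
theorem conj_unitary (hW : IsArchWeilDatum ι𝕎 ω) (u : Matrix.unitaryGroup σ ℂ) :
    IsArchWeilDatum ((MulAut.conj (realifySp σ u)).toMonoidHom.comp ι𝕎)
      (conjRep (unitaryEquivPi u).toLinearEquiv ω) :=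
  hW.conj' (implements_unitaryEquivPi u) (liftsTo_unitaryEquivPi u)

omit [TopologicalSpace Ginf] in
/-- The unitary change of polarisation fixes the Gaussian, so vacuum eigen-scalars are unchanged:
`ω g h₀ = c • h₀ → (μ₀(u) ω μ₀(u)⁻¹) g h₀ = c • h₀`. [cite: Folland1989, Prop. (4.39)] -/
theorem conjRep_unitary_hermitePi_zero (u : Matrix.unitaryGroup σ ℂ) {g : Ginf} {c : ℂ}
    (h : ω g (hermitePi 0) = c • hermitePi 0) :
    conjRep (unitaryEquivPi u).toLinearEquiv ω g (hermitePi 0) = c • hermitePi 0 :=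
  conjRep_apply_eq_smul _ ω (unitaryOpPi_hermitePi_zero u) h

end IsArchWeilDatum

end Literature.NumberTheory.Weil1964
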